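/-
Copyright: the b2b-balaban T⁴-continuum CRUX team, row NE7b OWNER lineage `t4-ne7b-p1` (gen 145). Project licence.
-/
import Mathlib

/-!
# TOOLS FOR THE WEIGHTED CLASS: INTERPOLATED SUPPORTED ENTRIES, WEIGHTED CAUCHY–SCHWARZ SLOT SUMS, THE HOMOGENEOUS TRIPLE BOUND
# (SCOPING-d17 (R), the repair of the located NO (648), first file).  (648): the order-4∕5 class sums its supported three-∕four-point
# terms `𝟙[X ≠ 0]·Q` (`X` an entry majorant `Hk_{pq}` or `K3_{abc}`, `Q` the tree-decay bound) by COUNTING the support of `X`, and the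
# count is not reproduced by the step.  THE REPAIR replaces counting by weighting, in three moves typed here abstractly (Mathlib only):
# (§1) INTERPOLATION — an entry with a decaying bound `|E| ≤ Q` and a homogeneous bound `|E| ≤ c·X` obeys `|E| ≤ √(c·X·Q)`: half the decay,
#      degree `½` in the majorant, and it still vanishes where `X` does;
# (§2) WEIGHTED CAUCHY–SCHWARZ SLOT SUMS — `Σ_i √(a_i)·c_i ≤ √(Σ_i θ_i a_i)·√(Σ_i c_i²∕θ_i)`: the free index of the pair is summed against a
#      WEIGHTED letter `Σθa` of the majorant and a summable-inverse weight (`Σ c²∕θ`, a geometry letter) — no support count;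
# (§3) THE HOMOGENEOUS TRIPLE BOUND — for a weight `w ≥ 0` (the tilt `e^{−U}`), a bounded centred vertex `|B − m| ≤ 2β` and two observables,
#      `|∫w(B − m)FG| ≤ 2β·√(∫wF²)·√(∫wG²)` (weighted Cauchy–Schwarz by the discriminant), and its normalised form — the `c·X` bound of (§1)
#      for the mixed cumulants with a Hessian (`β = Hk_{pq}`) or third-derivative (`β = K3_{abc}`) vertex, the variances being the class's
#      moment letters ((464)∕(503)) (row NE7b, node U5c; Mathlib only; [folklore]).

Cell `pub-balaban`, sub-cell `t4`, spine estimate NE7b (`T4WeightBudget.RelWeightBound`; the cell's OWN estimate — NOT PRINTED in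
[Bałaban 1983–89], NOT PROVED).  Crux-route work under `Spine/NE7b/` by the row OWNER (`t4-ne7b-p1` gen 145, file (649)) under FREEZE
(0)'s crux-prover clause; NOTHING of Bałaban's is named as a Lean object, valued or asserted; no `T4Continuum/Support` leaf typed; no
`def`, no notation; zero `sorry`.  Imports: Mathlib only.

WHAT IS PROVED ([folklore]): §1 **`abs_le_sqrt_mul_of_le`**, `abs_le_sqrt_of_supported`, `supported_vanishes`; §2 `sqrt_mul_eq_weighted`,
**`sum_sqrt_mul_le_weighted`**, `sum_sqrt_le_weighted`, `sum_sqrt_mul_le_letters`; §3 `integral_weighted_sq_expand`,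
**`weighted_integral_cauchy_schwarz`**, **`abs_weighted_triple_le`**, `abs_normalised_triple_le`; §4 toy.

HONEST (what this is NOT).  Abstract inequalities; the interpolated entries of `∂⁴W`∕`∂⁵W`, the weighted slot letters, the weighted OUTPUT
letters and the rate bookkeeping under rescaling (SCOPING-d17 (R-a)–(R-d)) are the next files; scalar skeleton ((A3), NC-NE7b-α UNRULED);
nothing of Bałaban's asserted.  BY-NAME EFFECT ON THE WALL: NONE.  NE7b NOT PRINTED ∕ NOT PROVED; spine PROVED 0∕9; rung (B)+1 — the
programme's measures remain FINITE-torus statements; NOT the mass gap, NOT Clay.  HONEST DEPENDENCY: continuum YM on T⁴ ⇐ BetaPertH ∧ nine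
spine estimates (0∕9 proved); BetaPertH ⇐ (D1) ∧ (D4) ∧ CAP+tail; G-an2-4 gates asym, D1 and NE2∕3∕4.
-/

set_option autoImplicit false

noncomputable section

namespace Summit.QuantumFields.BalabanUV.T4Continuum.NE7b.SupWeightedSlotTools

open Finset Real MeasureTheory
open scoped BigOperators

/-! ## §1. Interpolated supported entries -/

section Interpolation

/-- **INTERPOLATION**: two bounds for the same entry give their geometric mean, `|E| ≤ P`, `|E| ≤ Q ⟹ |E| ≤ √(PQ)`. [folklore] -/
theorem abs_le_sqrt_mul_of_le {E P Q : ℝ} (hP : |E| ≤ P) (hQ : |E| ≤ Q) : |E| ≤ Real.sqrt (P * Q) := by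
  have h : |E| ^ 2 ≤ P * Q := by
    rw [pow_two]
    exact mul_le_mul hP hQ (abs_nonneg _) ((abs_nonneg _).trans hP)
  have h2 := Real.abs_le_sqrt h
  rwa [abs_abs] at h2

/-- **The supported form**: a homogeneous bound `|E| ≤ c·X` in the majorant `X ≥ 0` and a decay bound `|E| ≤ Q` give `|E| ≤ √(c·X·Q)` —
the replacement of `𝟙[X ≠ 0]·Q`. [folklore] -/
theorem abs_le_sqrt_of_supported {E X c Q : ℝ} (hc : |E| ≤ c * X) (hQ : |E| ≤ Q) : |E| ≤ Real.sqrt (c * X * Q) :=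
  abs_le_sqrt_mul_of_le hc hQ

/-- The interpolated bound still vanishes off the support: `X = 0 ⟹ E = 0` under the homogeneous bound. [folklore] -/
theorem supported_vanishes {E X c : ℝ} (hc : |E| ≤ c * X) (hX : X = 0) : E = 0 := by
  rw [hX, mul_zero] at hc
  exact abs_eq_zero.1 (le_antisymm hc (abs_nonneg _))

end Interpolation

/-! ## §2. Weighted Cauchy–Schwarz slot sums -/

section SlotSums

variable {α : Type*}

/-- `√a·c = √(θa)·√(c²∕θ)` for `a, c ≥ 0`, `θ > 0`. [folklore] -/
theorem sqrt_mul_eq_weighted {a c θ : ℝ} (ha : 0 ≤ a) (hc : 0 ≤ c) (hθ : 0 < θ) :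
    Real.sqrt a * c = Real.sqrt (θ * a) * Real.sqrt (c ^ 2 / θ) := by
  rw [← Real.sqrt_mul (mul_nonneg hθ.le ha), show θ * a * (c ^ 2 / θ) = a * c ^ 2 by field_simp,
    Real.sqrt_mul ha, Real.sqrt_sq hc]

/-- **WEIGHTED CAUCHY–SCHWARZ SLOT SUM**: `Σ_i √(a_i)·c_i ≤ √(Σ_i θ_i a_i)·√(Σ_i c_i²∕θ_i)` for `a, c ≥ 0` and a positive weight `θ`.
[folklore] -/
theorem sum_sqrt_mul_le_weighted (s : Finset α) {a c θ : α → ℝ} (ha : ∀ i, 0 ≤ a i) (hc : ∀ i, 0 ≤ c i) (hθ : ∀ i, 0 < θ i) :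
    ∑ i ∈ s, Real.sqrt (a i) * c i ≤ Real.sqrt (∑ i ∈ s, θ i * a i) * Real.sqrt (∑ i ∈ s, c i ^ 2 / θ i) := by
  calc ∑ i ∈ s, Real.sqrt (a i) * c i = ∑ i ∈ s, Real.sqrt (θ i * a i) * Real.sqrt (c i ^ 2 / θ i) :=
        sum_congr rfl fun i _ => sqrt_mul_eq_weighted (ha i) (hc i) (hθ i)
    _ ≤ Real.sqrt (∑ i ∈ s, θ i * a i) * Real.sqrt (∑ i ∈ s, c i ^ 2 / θ i) :=
        Real.sum_sqrt_mul_sqrt_le s (fun i => mul_nonneg (hθ i).le (ha i)) (fun i => div_nonneg (sq_nonneg _) (hθ i).le)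

/-- **The bare form** (`c = 1`): `Σ_i √(a_i) ≤ √(Σ_i θ_i a_i)·√(Σ_i θ_i⁻¹)`. [folklore] -/
theorem sum_sqrt_le_weighted (s : Finset α) {a θ : α → ℝ} (ha : ∀ i, 0 ≤ a i) (hθ : ∀ i, 0 < θ i) :
    ∑ i ∈ s, Real.sqrt (a i) ≤ Real.sqrt (∑ i ∈ s, θ i * a i) * Real.sqrt (∑ i ∈ s, (θ i)⁻¹) := by
  have h := sum_sqrt_mul_le_weighted s (c := fun _ => (1 : ℝ)) ha (fun _ => zero_le_one) hθ
  simp only [mul_one, one_pow, one_div] at h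
  exact h

/-- **With the letters plugged**: a weighted letter `Σθa ≤ Aθ` of the majorant and a geometry letter `Σc²∕θ ≤ Sθ` give
`Σ_i √(a_i)·c_i ≤ √(Aθ·Sθ)`. [folklore] -/
theorem sum_sqrt_mul_le_letters (s : Finset α) {a c θ : α → ℝ} {Aθ Sθ : ℝ} (ha : ∀ i, 0 ≤ a i) (hc : ∀ i, 0 ≤ c i) (hθ : ∀ i, 0 < θ i)
    (hA : ∑ i ∈ s, θ i * a i ≤ Aθ) (hS : ∑ i ∈ s, c i ^ 2 / θ i ≤ Sθ) : ∑ i ∈ s, Real.sqrt (a i) * c i ≤ Real.sqrt (Aθ * Sθ) := by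
  refine (sum_sqrt_mul_le_weighted s ha hc hθ).trans ?_
  have h0 : 0 ≤ ∑ i ∈ s, θ i * a i := sum_nonneg fun i _ => mul_nonneg (hθ i).le (ha i)
  rw [← Real.sqrt_mul h0]
  exact Real.sqrt_le_sqrt (mul_le_mul hA hS (sum_nonneg fun i _ => div_nonneg (sq_nonneg _) (hθ i).le) (h0.trans hA))

end SlotSums

/-! ## §3. Weighted Cauchy–Schwarz for integrals; the homogeneous triple bound -/

section Integrals

variable {Ω : Type*} [MeasurableSpace Ω] {μ : Measure Ω}

/-- The expansion `∫w(tf − g)² = (∫wf²)t² − 2(∫wfg)t + ∫wg²`. [folklore] -/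
theorem integral_weighted_sq_expand {w f g : Ω → ℝ} (hfg : Integrable (fun ω => w ω * (f ω * g ω)) μ)
    (hf2 : Integrable (fun ω => w ω * f ω ^ 2) μ) (hg2 : Integrable (fun ω => w ω * g ω ^ 2) μ) (t : ℝ) :
    ∫ ω, w ω * (t * f ω - g ω) ^ 2 ∂μ =
      (∫ ω, w ω * f ω ^ 2 ∂μ) * (t * t) + (-2 * ∫ ω, w ω * (f ω * g ω) ∂μ) * t + ∫ ω, w ω * g ω ^ 2 ∂μ := by
  have e : (fun ω => w ω * (t * f ω - g ω) ^ 2) = fun ω => (t * t * (w ω * f ω ^ 2) - 2 * t * (w ω * (f ω * g ω))) + w ω * g ω ^ 2 := by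
    funext ω; ring
  have hA : ∫ ω, (t * t * (w ω * f ω ^ 2) - 2 * t * (w ω * (f ω * g ω))) + w ω * g ω ^ 2 ∂μ =
      (∫ ω, (t * t * (w ω * f ω ^ 2) - 2 * t * (w ω * (f ω * g ω))) ∂μ) + ∫ ω, w ω * g ω ^ 2 ∂μ :=
    integral_add ((hf2.const_mul (t * t)).sub (hfg.const_mul (2 * t))) hg2
  have hB : ∫ ω, (t * t * (w ω * f ω ^ 2) - 2 * t * (w ω * (f ω * g ω))) ∂μ =
      (∫ ω, t * t * (w ω * f ω ^ 2) ∂μ) - ∫ ω, 2 * t * (w ω * (f ω * g ω)) ∂μ :=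
    integral_sub (hf2.const_mul (t * t)) (hfg.const_mul (2 * t))
  rw [e, hA, hB, integral_const_mul, integral_const_mul]
  ring

/-- **WEIGHTED CAUCHY–SCHWARZ FOR INTEGRALS**: `(∫wfg)² ≤ (∫wf²)(∫wg²)` for a weight `w ≥ 0` (the discriminant of `t ↦ ∫w(tf − g)² ≥ 0`).
[folklore] -/
theorem weighted_integral_cauchy_schwarz {w f g : Ω → ℝ} (hw : ∀ ω, 0 ≤ w ω) (hfg : Integrable (fun ω => w ω * (f ω * g ω)) μ)
    (hf2 : Integrable (fun ω => w ω * f ω ^ 2) μ) (hg2 : Integrable (fun ω => w ω * g ω ^ 2) μ) :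
    (∫ ω, w ω * (f ω * g ω) ∂μ) ^ 2 ≤ (∫ ω, w ω * f ω ^ 2 ∂μ) * (∫ ω, w ω * g ω ^ 2 ∂μ) := by
  have hq : ∀ t : ℝ, 0 ≤ (∫ ω, w ω * f ω ^ 2 ∂μ) * (t * t) + (-2 * ∫ ω, w ω * (f ω * g ω) ∂μ) * t + ∫ ω, w ω * g ω ^ 2 ∂μ := fun t => by
    rw [← integral_weighted_sq_expand hfg hf2 hg2 t]
    exact integral_nonneg fun ω => mul_nonneg (hw ω) (sq_nonneg _)
  have hd := discrim_le_zero hq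
  rw [discrim] at hd
  nlinarith [hd]

/-- **THE HOMOGENEOUS TRIPLE BOUND**: a weight `w ≥ 0`, a bounded centred vertex `|B − m| ≤ 2β` (`β ≥ 0`) and two observables give
`|∫w·(B − m)·F·G| ≤ 2β·√(∫wF²)·√(∫wG²)` — NO decay, but degree one in the vertex's size `β`. [folklore] -/
theorem abs_weighted_triple_le {w B F G : Ω → ℝ} {m β : ℝ} (hw : ∀ ω, 0 ≤ w ω) (hβ : 0 ≤ β) (hB : ∀ ω, |B ω - m| ≤ 2 * β)
    (hFG : Integrable (fun ω => w ω * (|F ω| * |G ω|)) μ)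
    (hF2 : Integrable (fun ω => w ω * F ω ^ 2) μ) (hG2 : Integrable (fun ω => w ω * G ω ^ 2) μ) :
    |∫ ω, w ω * ((B ω - m) * F ω * G ω) ∂μ| ≤ 2 * β * Real.sqrt (∫ ω, w ω * F ω ^ 2 ∂μ) * Real.sqrt (∫ ω, w ω * G ω ^ 2 ∂μ) := by
  have hβ2 : 0 ≤ 2 * β := by positivity
  -- pointwise domination `|w(B−m)FG| ≤ 2β · w|F||G|`
  have h1 : |∫ ω, w ω * ((B ω - m) * F ω * G ω) ∂μ| ≤ ∫ ω, 2 * β * (w ω * (|F ω| * |G ω|)) ∂μ := by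
    refine (abs_integral_le_integral_abs).trans (integral_mono_of_nonneg (ae_of_all _ fun ω => abs_nonneg _) (hFG.const_mul _)
      (ae_of_all _ fun ω => ?_))
    simp only [abs_mul, abs_of_nonneg (hw ω)]
    calc w ω * (|B ω - m| * |F ω| * |G ω|) ≤ w ω * (2 * β * |F ω| * |G ω|) := by
          gcongr
          · exact hw ω
          · exact hB ω
      _ = 2 * β * (w ω * (|F ω| * |G ω|)) := by ring
  rw [integral_const_mul] at h1
  -- weighted Cauchy–Schwarz on `|F|, |G|`
  have hF2' : Integrable (fun ω => w ω * |F ω| ^ 2) μ := by simpa only [sq_abs] using hF2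
  have hG2' : Integrable (fun ω => w ω * |G ω| ^ 2) μ := by simpa only [sq_abs] using hG2
  have hcs := weighted_integral_cauchy_schwarz hw hFG hF2' hG2'
  simp only [sq_abs] at hcs
  have hI0 : 0 ≤ ∫ ω, w ω * (|F ω| * |G ω|) ∂μ := integral_nonneg fun ω => mul_nonneg (hw ω) (mul_nonneg (abs_nonneg _) (abs_nonneg _))
  have h2 : ∫ ω, w ω * (|F ω| * |G ω|) ∂μ ≤ Real.sqrt (∫ ω, w ω * F ω ^ 2 ∂μ) * Real.sqrt (∫ ω, w ω * G ω ^ 2 ∂μ) := by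
    rw [← Real.sqrt_mul (integral_nonneg fun ω => mul_nonneg (hw ω) (sq_nonneg _))]
    exact Real.le_sqrt_of_sq_le hcs
  calc |∫ ω, w ω * ((B ω - m) * F ω * G ω) ∂μ| ≤ 2 * β * ∫ ω, w ω * (|F ω| * |G ω|) ∂μ := h1
    _ ≤ 2 * β * (Real.sqrt (∫ ω, w ω * F ω ^ 2 ∂μ) * Real.sqrt (∫ ω, w ω * G ω ^ 2 ∂μ)) := mul_le_mul_of_nonneg_left h2 hβ2
    _ = 2 * β * Real.sqrt (∫ ω, w ω * F ω ^ 2 ∂μ) * Real.sqrt (∫ ω, w ω * G ω ^ 2 ∂μ) := by ring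

/-- **The normalised form**: for `Z > 0`, `|Z⁻¹∫w(B − m)FG| ≤ 2β·√(Z⁻¹∫wF²)·√(Z⁻¹∫wG²)` — tilted expectations, the variances being the class's
moment letters. [folklore] -/
theorem abs_normalised_triple_le {w B F G : Ω → ℝ} {m β Z : ℝ} (hZ : 0 < Z) (hw : ∀ ω, 0 ≤ w ω) (hβ : 0 ≤ β) (hB : ∀ ω, |B ω - m| ≤ 2 * β)
    (hFG : Integrable (fun ω => w ω * (|F ω| * |G ω|)) μ)
    (hF2 : Integrable (fun ω => w ω * F ω ^ 2) μ) (hG2 : Integrable (fun ω => w ω * G ω ^ 2) μ) :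
    |Z⁻¹ * ∫ ω, w ω * ((B ω - m) * F ω * G ω) ∂μ| ≤
      2 * β * Real.sqrt (Z⁻¹ * ∫ ω, w ω * F ω ^ 2 ∂μ) * Real.sqrt (Z⁻¹ * ∫ ω, w ω * G ω ^ 2 ∂μ) := by
  have h := abs_weighted_triple_le hw hβ hB hFG hF2 hG2
  have hZi : 0 ≤ Z⁻¹ := inv_nonneg.2 hZ.le
  rw [abs_mul, abs_of_nonneg hZi, Real.sqrt_mul hZi, Real.sqrt_mul hZi]
  have e : Real.sqrt Z⁻¹ * Real.sqrt Z⁻¹ = Z⁻¹ := Real.mul_self_sqrt hZi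
  calc Z⁻¹ * |∫ ω, w ω * ((B ω - m) * F ω * G ω) ∂μ|
      ≤ Z⁻¹ * (2 * β * Real.sqrt (∫ ω, w ω * F ω ^ 2 ∂μ) * Real.sqrt (∫ ω, w ω * G ω ^ 2 ∂μ)) := mul_le_mul_of_nonneg_left h hZi
    _ = (Real.sqrt Z⁻¹ * Real.sqrt Z⁻¹) * (2 * β * Real.sqrt (∫ ω, w ω * F ω ^ 2 ∂μ) * Real.sqrt (∫ ω, w ω * G ω ^ 2 ∂μ)) := by rw [e]
    _ = 2 * β * (Real.sqrt Z⁻¹ * Real.sqrt (∫ ω, w ω * F ω ^ 2 ∂μ)) * (Real.sqrt Z⁻¹ * Real.sqrt (∫ ω, w ω * G ω ^ 2 ∂μ)) := by ring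

end Integrals

/-! ## §4. Toy -/

/-- Toy (§1 in numbers): `|E| ≤ 4` and `|E| ≤ 1` give `|E| ≤ √4·1 = 2`. -/
example (E : ℝ) (h1 : |E| ≤ 4) (h2 : |E| ≤ 1) : |E| ≤ 2 := by
  have h := abs_le_sqrt_mul_of_le h1 h2
  have e : Real.sqrt (4 * 1) = 2 := by
    rw [mul_one, show (4 : ℝ) = 2 ^ 2 by norm_num, Real.sqrt_sq (by norm_num : (0 : ℝ) ≤ 2)]
  rwa [e] at h

end Summit.QuantumFields.BalabanUV.T4Continuum.NE7b.SupWeightedSlotTools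

end
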